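/-
Origin: expansion seat `prover-pub-hodgecm-mc-binder-2-g18-0`, handover #97 2026-08-20T22:14Z md5 09e97f586172 (NEW; 101 l.; ns `HodgeCM.Model.HermLineDatum` + `HodgeCM.Model.SplitLine`; (J4a-pin) THE TERMS for axioms-1 #4's `typeOf` ∕ `PhiMu` parameters on theta-3's K0 word (l.14550): data def `HermLineDatum.scalar ℓ := ℓ.JW 0 0` with `scalar_eq_algebraMap` (from `hJW : JW = TW.map algebraMap`), `conj_scalar` (`IsCMField.complexConj_apply_eq_self`), `TW_ne_zero` (`Matrix.det_fin_one` + `hWd : IsUnit TW.det`), `scalar_ne_zero`; data def **`HermLineDatum.lineType ℓ : CMType L := SignRecipe.lineType ℓ.scalar ℓ.conj_scalar ℓ.scalar_ne_zero`** (`lineType_eq` rfl), `lineType_eq_of_JW_eq_diagonal (ha ha0) (hJ : ℓ.JW = diagonal (lineVec L a)) : ℓ.lineType = SignRecipe.lineType a ha ha0` (the honest slot Gram lines); abbrevs `SplitLine.lineType p`, **`SplitLine.typeOfLine p := p.lineType`**, **`SplitLine.PhiMuLine ι₁ p := ι₁ ∈ (p.lineType).1`** (definitional predicate = the `PhiMu`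 slot's term, not a record) + `phiMuLine_iff` (Iff.rfl). CERT lane farm lean-direct over `g18/farm/mirror2` (campaign mirror, #4r3 f74a69e1ffe8 + #94): rc 0 ∕ 5 s ∕ 0 warn ∕ 0 proof holes; `#print axioms` 12 ∕ 12 ⊆ trio (`g18/farm/logs/campaign-ax_herm.log` 6773a65edc80); FQN 0 ∕ 12. NAME LIST (theorems): `HodgeCM.Model.HermLineDatum.conj_scalar` · `HodgeCM.Model.HermLineDatum.scalar_ne_zero` · `HodgeCM.Model.HermLineDatum.lineType_eq_of_JW_eq_diagonal`. (`HOME/mc/pub-hodgecm-mc-binder-2/g18/stage65/HodgeCM/Model/Binders/JLiuHermLineType.lean`, md5 09e97f586172, 101 lines);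
landed by the gen-27 packager (p-g27) in gate run 65 as `HodgeCM/Model/Binders/JLiuHermLineType.lean` (verbatim).
-/
/-
Copyright (c) 2026 the pub-hodgecm formalisation cell (harness21).  New file, not vendored.
Origin: session prover-pub-hodgecm-mc-binder-2-g18-0 (unit pub-hodgecm-mc-binder-2-g18, BINDER PROVER gen 18 of lineage mc-binder-2;
content lane (J-Liu-Θ), (J4a-pin) — the δ-positive type of axioms-1-g15's adèlic index `HermLineDatum` ∕ `SplitLine`, i.e. the TERM
for the `typeOf` ∕ `PhiMu` parameters of `liuDictionaryOfWeil`), 2026-08-20.  Intended final place: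
`HodgeCM/Model/Binders/JLiuHermLineType.lean` (NEW additive leaf; imports axioms-1 #4 `Model/LiuDictionaryInstance` (RUN 64, (iib-T) r3 in
RUN 65) and binder-2 #94 `Model/Binders/JLiuLineType` (RUN 64); nothing imports it).
-/
import Summits.HodgeConjecture.HodgeCM.Model.LiuDictionaryInstance
import Summits.HodgeConjecture.HodgeCM.Model.Binders.JLiuLineType

set_option autoImplicit false

/-!
# The type map of the Weil-coinvariant dictionary, pinned on the line scalar

axioms-1-g15's `liuDictionaryOfWeil … Good GoodChar PhiMu typeOf` (#4) leaves `PhiMu` and `typeOf` as PARAMETERS to be read off `s_∞`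
by the theta lane.  theta-3-g26's K0 WORD (STATUS 2026-08-20T22:07:03Z): on the guard, Liu's `Φ_μ` of the character behind the index
`p : SplitLine …` IS `Φ^δ(a_p) = SignRecipe.lineType a_p` for the line scalar `a_p`, and «`τ′ ∈ Φ_μ`» at `τ′ = ι₁` is `ι₁ ∈ Φ^δ(a_p)`.
This leaf supplies the TERMS:

* `HermLineDatum.scalar ℓ := ℓ.JW 0 0` with `conj_scalar` (`JW = TW.map algebraMap` is `L⁺`-rational) and `scalar_ne_zero` (`IsUnit TW.det`);
* `HermLineDatum.lineType ℓ : CMType L := Φ^δ(ℓ.scalar)`; `SplitLine.lineType p := p.toHermLineDatum.lineType`;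
* `HermLineDatum.lineType_eq_of_JW_eq_diagonal` — for the honest slot Gram line `JW = diagonal (lineVec L a)`: `ℓ.lineType = Φ^δ(a)`;
* the intended pins, as abbreviations: `SplitLine.typeOfLine p := p.lineType`, `SplitLine.PhiMuLine ι₁ p := ι₁ ∈ p.lineType`.
KERNEL: definitions + lemmas; 0 records, nothing cited, no `def … : Prop` of record (`PhiMuLine` is a definitional predicate, the `PhiMu` slot's
term); expected `#print axioms` ⊆ {propext, Classical.choice, Quot.sound}.
-/

noncomputable section

open NumberField
open Literature.AlgebraicGeometry.Motives (CMType)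
open Literature.AlgebraicGeometry.ShimuraVarieties (conjRingHomK)
open Literature.NumberTheory.GelbartRogawski1991.UnitaryDualPair (lineVec)

namespace HodgeCM.Model

namespace HermLineDatum

variable {L : CMField} (ℓ : HermLineDatum L)

/-- The line scalar `a = JW₀₀` of a hermitian line datum. -/
def scalar : L := ℓ.JW 0 0

/-- (Ported verbatim from the HodgeCMPerL package; no docstring in the source.) -/
theorem scalar_eq_algebraMap : ℓ.scalar = algebraMap _ (L : Type) (ℓ.TW 0 0) := by
  rw [scalar, ℓ.hJW, Matrix.map_apply]

/-- The line scalar is totally real (`ā = a`): it comes from `L⁺`. -/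
theorem conj_scalar : conjRingHomK L ℓ.scalar = ℓ.scalar := by
  rw [scalar_eq_algebraMap]
  exact IsCMField.complexConj_apply_eq_self (K := (L : Type)) (ℓ.TW 0 0)

/-- (Ported verbatim from the HodgeCMPerL package; no docstring in the source.) -/
theorem TW_ne_zero : ℓ.TW 0 0 ≠ 0 := by
  have h := ℓ.hWd
  rw [Matrix.det_fin_one] at h
  exact h.ne_zero

/-- … and non-zero (`det TW = TW₀₀` is a unit). -/
theorem scalar_ne_zero : ℓ.scalar ≠ 0 := by
  rw [scalar_eq_algebraMap]
  exact (map_ne_zero _).mpr ℓ.TW_ne_zero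

/-- **The δ-positive type `Φ^δ(a_ℓ)` of the hermitian line datum** (binder-2 #94 `SignRecipe.lineType` at the line scalar). -/
def lineType : CMType L := SignRecipe.lineType ℓ.scalar ℓ.conj_scalar ℓ.scalar_ne_zero

/-- (Ported verbatim from the HodgeCMPerL package; no docstring in the source.) -/
theorem lineType_eq : ℓ.lineType = SignRecipe.lineType ℓ.scalar ℓ.conj_scalar ℓ.scalar_ne_zero := rfl

/-- For the honest slot Gram line `JW = diagonal (lineVec L a)` the type is `Φ^δ(a)`. -/
theorem lineType_eq_of_JW_eq_diagonal {a : L} (ha : conjRingHomK L a = a) (ha0 : a ≠ 0)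
    (hJ : ℓ.JW = Matrix.diagonal (lineVec (L : Type) a)) : ℓ.lineType = SignRecipe.lineType a ha ha0 :=
  SignRecipe.lineType_congr (by rw [scalar, hJ, Matrix.diagonal_apply_eq]) _ _ _ _

end HermLineDatum

namespace SplitLine

variable {L : CMField} {ι₁ : (L : Type) →+* ℂ} {V : HermSpace3 L ι₁}
  {JV : Matrix (Fin 3) (Fin 3) (L : Type)} {TV : Matrix (Fin 3) (Fin 3) ↥(maximalRealSubfield (L : Type))}
  {δ : (L : Type)} {hcδ : IsCMField.complexConj (L : Type) δ = -δ} {hδ : δ ≠ 0} {d : ↥(maximalRealSubfield (L : Type))}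
  {hd : δ * δ = algebraMap _ (L : Type) d} {hV : TV.IsSymm} {hVd : IsUnit TV.det}
  {hJV : JV = TV.map (algebraMap _ (L : Type))}

/-- The δ-positive type of the index `p` (its line's). -/
abbrev lineType (p : SplitLine JV TV hcδ hδ hd hV hVd hJV) : CMType L := p.toHermLineDatum.lineType

/-- **The intended `typeOf` pin** of `liuDictionaryOfWeil`: `typeOf p := Φ^δ(a_p)`. -/
abbrev typeOfLine (p : SplitLine JV TV hcδ hδ hd hV hVd hJV) : CMType L := p.lineType

variable (ι₁) in
/-- **The intended `PhiMu` pin**: «`τ′ ∈ Φ_μ`» at `τ′ = ι₁`, i.e. `ι₁ ∈ Φ^δ(a_p)`. -/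
abbrev PhiMuLine (p : SplitLine JV TV hcδ hδ hd hV hVd hJV) : Prop := ι₁ ∈ (p.lineType).1

/-- (Ported verbatim from the HodgeCMPerL package; no docstring in the source.) -/
theorem phiMuLine_iff (p : SplitLine JV TV hcδ hδ hd hV hVd hJV) :
    PhiMuLine ι₁ p ↔ 0 < (ι₁ (SignRecipe.eta L * p.toHermLineDatum.scalar)).im := Iff.rfl

end SplitLine

end HodgeCM.Model

end
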